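import Summits.AnomalousDissipation.AnomalousDissipation.Theorems.SolenoidalFractalHomogenisationLagrangianStepW7ThreeModeFibre
import Literature.Analysis.FluidPDE.PassiveVectorTensorFourier
import Literature.Analysis.FunctionSpaces.TorusFourierModes
import HarnessLib

/-!
# K1L_D (stmt-AnomalousDissipation-27980), (V_mod) flat stage (ℓ2): the GENERATOR applied to a BAND-LIMITED SOLENOIDAL TEST, paired with a
# solenoidal `L²` slice — the test-side bound that pays every SHORT window of the flat blocks (certifier table
# `Cruxes/LagrangianRenormalisationStep/Lines/onelevel-ss-regimes.md` §2 T-G / §4; prover ad-k1loc-p3 g10, `--supports 27980 --as helper`)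

For a bounded measurable carrier `b` (`‖b x‖ ≤ B`), a constant tensor `𝔹` with `NearIso 𝔹 lo hi` (`0 ≤ lo`, `0 ≤ hi`) and `OddSmall 𝔹 β`
(`0 ≤ β`), a weakly divergence-free `u ∈ L²` (the slice) and a weakly divergence-free `w ∈ L²` whose truncation `G = P_N w`
(`Torus.fourierTruncate N w`) is the test:

  `|∫ ⟪u, (b·∇)G + 𝓛_𝔹^* G⟫| ≤ (6π·B + 4π²·(hi + β/2)·N) · S_N(w) · ‖u‖₂`,   `S_N(w)² := Σ_{|k| ≤ N} |k|²·‖ŵ(k)‖²`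

(`abs_integral_inner_generator_fourierTruncate_le`), from the two separate bounds
* transport `|∫ ⟪u, (b·∇)G⟫| ≤ 6π·B·S_N(w)·‖u‖₂` (`abs_integral_inner_convect_fourierTruncate_le`: `⟪u, (b·∇)G⟫ = Σⱼ ⟪bⱼu, ∂ⱼG⟫`, the pairing
  formula `Torus.integral_inner_realTrigPoly_of_integrable` for the trigonometric polynomial `∂ⱼG`, Cauchy–Schwarz over the ball, Bessel for `bⱼu`);
* diffusion `|∫ ⟪u, 𝓛_𝔹^*G⟫| ≤ 4π²(hi + β/2)·N·S_N(w)·‖u‖₂` (`abs_integral_inner_viscAdj_fourierTruncate_le`: `𝓛_𝔹^* G` is the trigonometric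
  polynomial with coefficients `−4π² T_𝔹(k) ŵ(k)` (`Torus.viscAdj_realTrigPoly_singleton` summed), the pairing formula, the bilinear window bound
  `ThreeMode.re_inner_symbT_le` on the transversal coefficients of `u` and `w`, Cauchy–Schwarz, `|k| ≤ N` on the ball, Bessel for `u`).
With `PassiveVectorTensorPropagatorTestIdentity` (p710945) this gives `|⟪U s t x, G⟫ − ⟪x, G⟫| ≤ (t − s)·(6πB + 4π²(hi+β/2)N)·S_N·‖x‖` for the
cell propagator — the generator-level («τ < P») row of every (ℓ2) block; the (fs) instance is the next file.
NOT a proof of any block, of `stub_Vmod_of_VRH`, of K1L_D or of AD; rung F-D1.A0.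
-/

set_option linter.dupNamespace false

noncomputable section

namespace Summit.AnomalousDissipation.AnomalousDissipation.Theorems.SolenoidalFractalHomogenisation.LagrangianStep.VmodFlat

open Literature.Analysis Literature.Analysis.FluidPDE Literature.Analysis.FunctionSpaces
open Literature.Analysis.FluidPDE.Torus Literature.Analysis.FunctionSpaces.Torus
open MeasureTheory Set Filter UnitAddTorus Complex
open scoped ENNReal NNReal InnerProductSpace
open Summit.AnomalousDissipation.AnomalousDissipation.Theorems.SolenoidalFractalHomogenisation.LagrangianStep.ThreeMode (re_inner_symbT_le)

/-! ## §1 Bessel over the ball and the product `bⱼ • u` -/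

/-- Bessel on the ball: `Σ_{|k| ≤ N} ‖û(k)‖² ≤ ∫ ‖u‖²` for `u ∈ L²`. [folklore] -/
theorem sum_norm_sq_mFourierCoeff_le_integral {u : UnitAddTorus (Fin 3) → EuclideanSpace ℝ (Fin 3)} (hu : MemLp u 2 volume) (S : Finset (Fin 3 → ℤ)) :
    ∑ k ∈ S, ‖mFourierCoeff (EuclideanSpace.complexify ∘ u) k‖ ^ 2 ≤ ∫ x, ‖u x‖ ^ 2 :=
  sum_le_hasSum S (fun _ _ => sq_nonneg _) (hasSum_sq_norm_mFourierCoeff_complexify hu)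

/-- The product of a bounded measurable scalar component of the carrier with an `L²` field is in `L²`, with
`∫ ‖bⱼ u‖² ≤ B² ∫ ‖u‖²`. [folklore] -/
theorem memLp_carrier_smul {u b : UnitAddTorus (Fin 3) → EuclideanSpace ℝ (Fin 3)} (hu : MemLp u 2 volume) (hb : AEStronglyMeasurable b volume) {B : ℝ}
    (hB : ∀ x, ‖b x‖ ≤ B) (j : Fin 3) :
    MemLp (fun x => b x j • u x) 2 volume ∧ ∫ x, ‖b x j • u x‖ ^ 2 ≤ B ^ 2 * ∫ x, ‖u x‖ ^ 2 := by
  have hbj : AEStronglyMeasurable (fun x => b x j) volume :=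
    (EuclideanSpace.proj j : EuclideanSpace ℝ (Fin 3) →L[ℝ] ℝ).continuous.comp_aestronglyMeasurable hb
  have hmeas : AEStronglyMeasurable (fun x => b x j • u x) volume := hbj.smul hu.1
  have hpt : ∀ x, ‖b x j • u x‖ ≤ B * ‖u x‖ := fun x => by
    rw [norm_smul]
    refine mul_le_mul_of_nonneg_right ?_ (norm_nonneg _)
    exact (by simpa using PiLp.norm_apply_le (b x) j : ‖b x j‖ ≤ ‖b x‖).trans (hB x)
  have hmem : MemLp (fun x => b x j • u x) 2 volume := MemLp.of_le_mul hu hmeas (Eventually.of_forall hpt)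
  refine ⟨hmem, ?_⟩
  have hi1 : Integrable (fun x => ‖u x‖ ^ 2) volume := (memLp_two_iff_integrable_sq_norm hu.1).1 hu
  calc ∫ x, ‖b x j • u x‖ ^ 2 ≤ ∫ x, B ^ 2 * ‖u x‖ ^ 2 := by
        refine integral_mono_of_nonneg (Eventually.of_forall fun x => sq_nonneg _) (hi1.const_mul _)
          (Eventually.of_forall fun x => ?_)
        have h := hpt x
        have h0 : 0 ≤ ‖b x j • u x‖ := norm_nonneg _
        calc ‖b x j • u x‖ ^ 2 ≤ (B * ‖u x‖) ^ 2 := pow_le_pow_left₀ h0 h 2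
          _ = B ^ 2 * ‖u x‖ ^ 2 := by ring
    _ = B ^ 2 * ∫ x, ‖u x‖ ^ 2 := integral_const_mul _ _

/-! ## §2 The transport pairing -/

/-- `⟪u, (b·∇)G⟫ = Σⱼ ⟪bⱼ • u, ∂ⱼ G⟫` pointwise, for a `C¹` test. [folklore] -/
theorem inner_convect_eq_sum_smul {u b G : UnitAddTorus (Fin 3) → EuclideanSpace ℝ (Fin 3)} (hG : Torus.IsContDiff 1 G) (x : UnitAddTorus (Fin 3)) :
    ⟪u x, Torus.convect b G x⟫_ℝ = ∑ j, ⟪b x j • u x, Torus.partialDeriv j G x⟫_ℝ := by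
  rw [show Torus.convect b G x = Torus.fderiv G x (b x) from rfl, fderiv_apply_eq_sum_partialDeriv hG, inner_sum]
  refine Finset.sum_congr rfl fun j _ => ?_
  rw [real_inner_smul_right, real_inner_smul_left]

/-- **Transport pairing with a truncation**: `|∫ ⟪u, (b·∇)P_N w⟫| ≤ 6π·B·S_N(w)·‖u‖₂`. [folklore] -/
theorem abs_integral_inner_convect_fourierTruncate_le {u b : UnitAddTorus (Fin 3) → EuclideanSpace ℝ (Fin 3)} (w : UnitAddTorus (Fin 3) → EuclideanSpace ℝ (Fin 3)) (hu : MemLp u 2 volume)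
    (hb : AEStronglyMeasurable b volume) {B : ℝ} (hB0 : 0 ≤ B) (hB : ∀ x, ‖b x‖ ≤ B) (N : ℕ) :
    |∫ x, ⟪u x, Torus.convect b (fourierTruncate N w) x⟫_ℝ|
      ≤ 6 * Real.pi * B * Real.sqrt ((∑ k ∈ freqBall N, freqNormSq k * ‖mFourierCoeff (EuclideanSpace.complexify ∘ w) k‖ ^ 2)) * Real.sqrt (∫ x, ‖u x‖ ^ 2) := by
  set c : (Fin 3 → ℤ) → EuclideanSpace ℂ (Fin 3) := fun k => mFourierCoeff (EuclideanSpace.complexify ∘ w) k with hc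
  set G := fourierTruncate N w with hGdef
  have hGeq : G = realTrigPoly (freqBall N) c := rfl
  have hG1 : Torus.IsContDiff 1 G := (isSmooth_fourierTruncate N w).isContDiff (by simp)
  -- the products `bⱼ u`
  have hprod := fun j => memLp_carrier_smul hu hb hB j
  have hint : ∀ j, Integrable (fun x => b x j • u x) volume := fun j => (hprod j).1.integrable one_le_two
  -- pointwise and integrated splitting over `j`
  have hpt : ∀ x, ⟪u x, Torus.convect b G x⟫_ℝ = ∑ j, ⟪b x j • u x, Torus.partialDeriv j G x⟫_ℝ :=
    fun x => inner_convect_eq_sum_smul hG1 x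
  have hintj : ∀ j, Integrable (fun x => ⟪b x j • u x, Torus.partialDeriv j G x⟫_ℝ) volume := fun j =>
    integrable_inner_of_continuous (hint j) ((isSmooth_fourierTruncate N w).partialDeriv j).continuous
  simp_rw [hpt]
  rw [integral_finsetSum _ fun j _ => hintj j]
  -- each `j`: the pairing formula and Cauchy–Schwarz over the ball
  have hj : ∀ j, |∫ x, ⟪b x j • u x, Torus.partialDeriv j G x⟫_ℝ| ≤
      2 * Real.pi * B * Real.sqrt ((∑ k ∈ freqBall N, freqNormSq k * ‖mFourierCoeff (EuclideanSpace.complexify ∘ w) k‖ ^ 2)) * Real.sqrt (∫ x, ‖u x‖ ^ 2) := by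
    intro j
    rw [hGeq, partialDeriv_realTrigPoly' (freqBall N) c j, integral_inner_realTrigPoly_of_integrable _ _ (hint j)]
    set f : (Fin 3 → ℤ) → EuclideanSpace ℂ (Fin 3) := fun k => mFourierCoeff (EuclideanSpace.complexify ∘ fun x => b x j • u x) k with hf
    -- termwise bound `|Re ⟪f̂ⱼ(k), 2πi kⱼ ĉ(k)⟫| ≤ ‖f̂ⱼ(k)‖ · (2π |kⱼ| ‖ĉ(k)‖)`
    have hterm : ∀ k, |(⟪f k, (2 * Real.pi * I * (k j : ℂ)) • c k⟫_ℂ).re| ≤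
        ‖f k‖ * (2 * Real.pi * |(k j : ℝ)| * ‖c k‖) := by
      intro k
      refine (Complex.abs_re_le_norm _).trans ((norm_inner_le_norm _ _).trans (le_of_eq ?_))
      rw [norm_smul]
      congr 1
      rw [show (2 * Real.pi * I * (k j : ℂ) : ℂ) = ((2 * Real.pi * (k j : ℝ) : ℝ) : ℂ) * I by push_cast; ring,
        norm_mul, Complex.norm_I, mul_one, Complex.norm_real, Real.norm_eq_abs, abs_mul, abs_of_pos Real.two_pi_pos]
    have hsum_f : ∑ k ∈ freqBall N, ‖f k‖ ^ 2 ≤ B ^ 2 * ∫ x, ‖u x‖ ^ 2 :=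
      (sum_norm_sq_mFourierCoeff_le_integral (hprod j).1 _).trans (hprod j).2
    have hsum_c : ∑ k ∈ freqBall N, (2 * Real.pi * |(k j : ℝ)| * ‖c k‖) ^ 2 ≤ (2 * Real.pi) ^ 2 * (∑ k ∈ freqBall N, freqNormSq k * ‖mFourierCoeff (EuclideanSpace.complexify ∘ w) k‖ ^ 2) := by
      rw [Finset.mul_sum]
      refine Finset.sum_le_sum fun k _ => ?_
      have hkj : |(k j : ℝ)| ^ 2 ≤ freqNormSq k := by
        rw [sq_abs, freqNormSq]
        exact Finset.single_le_sum (f := fun i => ((k i : ℝ)) ^ 2) (fun _ _ => sq_nonneg _) (Finset.mem_univ j)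
      have := Real.pi_pos
      calc (2 * Real.pi * |(k j : ℝ)| * ‖c k‖) ^ 2 = (2 * Real.pi) ^ 2 * (|(k j : ℝ)| ^ 2 * ‖c k‖ ^ 2) := by ring
        _ ≤ (2 * Real.pi) ^ 2 * (freqNormSq k * ‖c k‖ ^ 2) := by gcongr
        _ = (2 * Real.pi) ^ 2 * (freqNormSq k * ‖mFourierCoeff (EuclideanSpace.complexify ∘ w) k‖ ^ 2) := by rw [hc]
    calc |∑ k ∈ freqBall N, (⟪f k, (2 * Real.pi * I * (k j : ℂ)) • c k⟫_ℂ).re|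
        ≤ ∑ k ∈ freqBall N, |(⟪f k, (2 * Real.pi * I * (k j : ℂ)) • c k⟫_ℂ).re| := Finset.abs_sum_le_sum_abs _ _
      _ ≤ ∑ k ∈ freqBall N, ‖f k‖ * (2 * Real.pi * |(k j : ℝ)| * ‖c k‖) := Finset.sum_le_sum fun k _ => hterm k
      _ ≤ Real.sqrt (∑ k ∈ freqBall N, ‖f k‖ ^ 2) * Real.sqrt (∑ k ∈ freqBall N, (2 * Real.pi * |(k j : ℝ)| * ‖c k‖) ^ 2) :=
          Real.sum_mul_le_sqrt_mul_sqrt _ _ _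
      _ ≤ Real.sqrt (B ^ 2 * ∫ x, ‖u x‖ ^ 2) * Real.sqrt ((2 * Real.pi) ^ 2 * (∑ k ∈ freqBall N, freqNormSq k * ‖mFourierCoeff (EuclideanSpace.complexify ∘ w) k‖ ^ 2)) := by
          gcongr
      _ = 2 * Real.pi * B * Real.sqrt ((∑ k ∈ freqBall N, freqNormSq k * ‖mFourierCoeff (EuclideanSpace.complexify ∘ w) k‖ ^ 2)) * Real.sqrt (∫ x, ‖u x‖ ^ 2) := by
          have := Real.pi_pos
          rw [Real.sqrt_mul (sq_nonneg _), Real.sqrt_mul (sq_nonneg _), Real.sqrt_sq hB0,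
            Real.sqrt_sq (by positivity)]
          ring
  calc |∑ j, ∫ x, ⟪b x j • u x, Torus.partialDeriv j G x⟫_ℝ|
      ≤ ∑ j, |∫ x, ⟪b x j • u x, Torus.partialDeriv j G x⟫_ℝ| := Finset.abs_sum_le_sum_abs _ _
    _ ≤ ∑ _j : Fin 3, 2 * Real.pi * B * Real.sqrt ((∑ k ∈ freqBall N, freqNormSq k * ‖mFourierCoeff (EuclideanSpace.complexify ∘ w) k‖ ^ 2)) * Real.sqrt (∫ x, ‖u x‖ ^ 2) :=
        Finset.sum_le_sum fun j _ => hj j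
    _ = 6 * Real.pi * B * Real.sqrt ((∑ k ∈ freqBall N, freqNormSq k * ‖mFourierCoeff (EuclideanSpace.complexify ∘ w) k‖ ^ 2)) * Real.sqrt (∫ x, ‖u x‖ ^ 2) := by
        rw [Finset.sum_const, Finset.card_univ, Fintype.card_fin]
        simp only [nsmul_eq_mul, Nat.cast_ofNat]
        ring

/-! ## §3 The diffusion pairing -/

/-- `𝓛_𝔹^*` is additive over finite sums of smooth fields (and the sum is smooth). [folklore] -/
theorem viscAdj_finset_sum {ι : Type*} (𝔹 : Visc4 (Fin 3)) (s : Finset ι) {f : ι → UnitAddTorus (Fin 3) → EuclideanSpace ℝ (Fin 3)} (hf : ∀ i, Torus.IsSmooth (f i)) :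
    Torus.IsSmooth (fun y => ∑ i ∈ s, f i y) ∧ ∀ x, viscAdj 𝔹 (fun y => ∑ i ∈ s, f i y) x = ∑ i ∈ s, viscAdj 𝔹 (f i) x := by
  classical
  induction s using Finset.induction_on with
  | empty =>
    refine ⟨?_, fun x => ?_⟩
    · simp only [Finset.sum_empty]
      exact (contDiff_const : ContDiff ℝ _ fun _ : EuclideanSpace ℝ (Fin 3) => (0 : EuclideanSpace ℝ (Fin 3)))
    · simp only [Finset.sum_empty]
      exact viscAdj_zero_field 𝔹 x
  | insert a s ha ih =>
    have e : (fun y => ∑ i ∈ insert a s, f i y) = f a + fun y => ∑ i ∈ s, f i y := by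
      funext y; rw [Finset.sum_insert ha]; rfl
    refine ⟨?_, fun x => ?_⟩
    · rw [e]; exact (hf a).add ih.1
    · rw [e, viscAdj_add_field 𝔹 (hf a) ih.1 x, ih.2 x, Finset.sum_insert ha]

/-- **`𝓛_𝔹^*` of a real trigonometric polynomial is the trigonometric polynomial with coefficients `−4π² T_𝔹(k) c k`**
(`Torus.viscAdj_realTrigPoly_singleton` summed over the modes). [folklore] -/
theorem viscAdj_realTrigPoly (𝔹 : Visc4 (Fin 3)) (S : Finset (Fin 3 → ℤ)) (c : (Fin 3 → ℤ) → EuclideanSpace ℂ (Fin 3)) (x : UnitAddTorus (Fin 3)) :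
    viscAdj 𝔹 (realTrigPoly S c) x = realTrigPoly S (fun k => ((-(4 * Real.pi ^ 2 : ℝ) : ℂ)) • symbT 𝔹 k (c k)) x := by
  have hsum : realTrigPoly S c = fun y => ∑ k ∈ S, realTrigPoly {k} c y := by
    funext y
    rw [realTrigPoly_apply_eq_sum]
    refine Finset.sum_congr rfl fun k _ => ?_
    rw [realTrigPoly_apply_eq_sum, Finset.sum_singleton]
  rw [hsum, (viscAdj_finset_sum 𝔹 S fun k => isSmooth_realTrigPoly {k} c).2 x]
  simp_rw [viscAdj_realTrigPoly_singleton 𝔹]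
  rw [realTrigPoly_apply_eq_sum]
  refine Finset.sum_congr rfl fun k _ => ?_
  rw [realTrigPoly_apply_eq_sum, Finset.sum_singleton]

/-- Transversality of the Fourier coefficients of a weakly divergence-free `L²` field, in `kdot` form. [folklore] -/
theorem kdot_mFourierCoeff_eq_zero {u : UnitAddTorus (Fin 3) → EuclideanSpace ℝ (Fin 3)} (hu : MemLp u 2 volume) (hdiv : Torus.IsWeaklyDivFree u) (k : Fin 3 → ℤ) :
    kdot k (mFourierCoeff (EuclideanSpace.complexify ∘ u) k) = 0 := by
  rw [kdot_apply]
  exact hdiv.isTransversal_mFourierCoeff hu {k} k (Finset.mem_singleton_self k)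

/-- `|Re ⟪a, T_𝔹(k) z⟫| ≤ (hi + β/2)·|k|²·‖z‖·‖a‖` for transversal `a, z` (`ThreeMode.re_inner_symbT_le` applied to `±a`). [folklore] -/
theorem abs_re_inner_symbT_le {𝔹 : Visc4 (Fin 3)} {lo hi β : ℝ} (h𝔹 : NearIso 𝔹 lo hi) (hlo : 0 ≤ lo) (hhi : 0 ≤ hi)
    (hodd : OddSmall 𝔹 β) (hβ : 0 ≤ β) (k : Fin 3 → ℤ) {a z : EuclideanSpace ℂ (Fin 3)} (ha : kdot k a = 0) (hz : kdot k z = 0) :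
    |(⟪a, symbT 𝔹 k z⟫_ℂ).re| ≤ (hi + β / 2) * freqNormSq k * (‖z‖ * ‖a‖) := by
  have h1 := re_inner_symbT_le h𝔹 hlo hhi hodd hβ k ha hz
  have ha' : kdot k (-a) = 0 := by rw [map_neg, ha, neg_zero]
  have h2 := re_inner_symbT_le h𝔹 hlo hhi hodd hβ k ha' hz
  rw [inner_neg_left, Complex.neg_re, norm_neg] at h2
  exact abs_le.2 ⟨by linarith, h1⟩

/-- **Diffusion pairing with a truncation**: `|∫ ⟪u, 𝓛_𝔹^* P_N w⟫| ≤ 4π²(hi + β/2)·N·S_N(w)·‖u‖₂` for weakly divergence-free `u, w ∈ L²`. [folklore] -/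
theorem abs_integral_inner_viscAdj_fourierTruncate_le {u w : UnitAddTorus (Fin 3) → EuclideanSpace ℝ (Fin 3)} (hu : MemLp u 2 volume) (hudiv : Torus.IsWeaklyDivFree u)
    (hw : MemLp w 2 volume) (hwdiv : Torus.IsWeaklyDivFree w)
    {𝔹 : Visc4 (Fin 3)} {lo hi β : ℝ} (h𝔹 : NearIso 𝔹 lo hi) (hlo : 0 ≤ lo) (hhi : 0 ≤ hi) (hodd : OddSmall 𝔹 β) (hβ : 0 ≤ β) (N : ℕ) :
    |∫ x, ⟪u x, viscAdj 𝔹 (fourierTruncate N w) x⟫_ℝ|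
      ≤ 4 * Real.pi ^ 2 * (hi + β / 2) * N * Real.sqrt ((∑ k ∈ freqBall N, freqNormSq k * ‖mFourierCoeff (EuclideanSpace.complexify ∘ w) k‖ ^ 2)) * Real.sqrt (∫ x, ‖u x‖ ^ 2) := by
  set c : (Fin 3 → ℤ) → EuclideanSpace ℂ (Fin 3) := fun k => mFourierCoeff (EuclideanSpace.complexify ∘ w) k with hc
  set a : (Fin 3 → ℤ) → EuclideanSpace ℂ (Fin 3) := fun k => mFourierCoeff (EuclideanSpace.complexify ∘ u) k with ha
  have hGeq : fourierTruncate N w = realTrigPoly (freqBall N) c := rfl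
  rw [hGeq]
  simp_rw [viscAdj_realTrigPoly 𝔹 (freqBall N) c]
  rw [integral_inner_realTrigPoly_of_integrable _ _ (hu.integrable one_le_two)]
  -- termwise bound
  have hterm : ∀ k ∈ freqBall N, |(⟪a k, ((-(4 * Real.pi ^ 2 : ℝ) : ℂ)) • symbT 𝔹 k (c k)⟫_ℂ).re|
      ≤ (Real.sqrt (freqNormSq k) * ‖a k‖) * (4 * Real.pi ^ 2 * (hi + β / 2) * (Real.sqrt (freqNormSq k) * ‖c k‖)) := by
    intro k hk
    rw [inner_smul_right, neg_mul, Complex.neg_re, Complex.re_ofReal_mul, abs_neg, abs_mul,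
      abs_of_pos (by positivity : (0:ℝ) < 4 * Real.pi ^ 2)]
    have h := abs_re_inner_symbT_le h𝔹 hlo hhi hodd hβ k (kdot_mFourierCoeff_eq_zero hu hudiv k) (kdot_mFourierCoeff_eq_zero hw hwdiv k)
    have hsq : Real.sqrt (freqNormSq k) * Real.sqrt (freqNormSq k) = freqNormSq k := Real.mul_self_sqrt (freqNormSq_nonneg k)
    calc 4 * Real.pi ^ 2 * |(⟪a k, symbT 𝔹 k (c k)⟫_ℂ).re| ≤ 4 * Real.pi ^ 2 * ((hi + β / 2) * freqNormSq k * (‖c k‖ * ‖a k‖)) := by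
          gcongr
      _ = (Real.sqrt (freqNormSq k) * ‖a k‖) * (4 * Real.pi ^ 2 * (hi + β / 2) * (Real.sqrt (freqNormSq k) * ‖c k‖)) := by
          rw [show (Real.sqrt (freqNormSq k) * ‖a k‖) * (4 * Real.pi ^ 2 * (hi + β / 2) * (Real.sqrt (freqNormSq k) * ‖c k‖))
              = 4 * Real.pi ^ 2 * ((hi + β / 2) * (Real.sqrt (freqNormSq k) * Real.sqrt (freqNormSq k)) * (‖c k‖ * ‖a k‖)) by ring, hsq]
  -- Cauchy–Schwarz over the ball
  have hsum_a : ∑ k ∈ freqBall N, (Real.sqrt (freqNormSq k) * ‖a k‖) ^ 2 ≤ (N : ℝ) ^ 2 * ∫ x, ‖u x‖ ^ 2 := by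
    calc ∑ k ∈ freqBall N, (Real.sqrt (freqNormSq k) * ‖a k‖) ^ 2
        = ∑ k ∈ freqBall N, freqNormSq k * ‖a k‖ ^ 2 := Finset.sum_congr rfl fun k _ => by
            rw [mul_pow, Real.sq_sqrt (freqNormSq_nonneg k)]
      _ ≤ ∑ k ∈ freqBall N, (N : ℝ) ^ 2 * ‖a k‖ ^ 2 := Finset.sum_le_sum fun k hk =>
            mul_le_mul_of_nonneg_right (mem_freqBall.1 hk) (sq_nonneg _)
      _ = (N : ℝ) ^ 2 * ∑ k ∈ freqBall N, ‖a k‖ ^ 2 := by rw [Finset.mul_sum]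
      _ ≤ (N : ℝ) ^ 2 * ∫ x, ‖u x‖ ^ 2 := mul_le_mul_of_nonneg_left (sum_norm_sq_mFourierCoeff_le_integral hu _) (sq_nonneg _)
  have hsum_c : ∑ k ∈ freqBall N, (4 * Real.pi ^ 2 * (hi + β / 2) * (Real.sqrt (freqNormSq k) * ‖c k‖)) ^ 2
      = (4 * Real.pi ^ 2 * (hi + β / 2)) ^ 2 * (∑ k ∈ freqBall N, freqNormSq k * ‖mFourierCoeff (EuclideanSpace.complexify ∘ w) k‖ ^ 2) := by
    rw [Finset.mul_sum]
    refine Finset.sum_congr rfl fun k _ => ?_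
    simp only [hc]
    have e : (4 * Real.pi ^ 2 * (hi + β / 2) * (Real.sqrt (freqNormSq k) * ‖mFourierCoeff (EuclideanSpace.complexify ∘ w) k‖)) ^ 2
        = (4 * Real.pi ^ 2 * (hi + β / 2)) ^ 2 * (Real.sqrt (freqNormSq k) ^ 2 * ‖mFourierCoeff (EuclideanSpace.complexify ∘ w) k‖ ^ 2) := by
      ring
    rw [e, Real.sq_sqrt (freqNormSq_nonneg k)]
  have hpos : 0 ≤ 4 * Real.pi ^ 2 * (hi + β / 2) := by positivity
  calc |∑ k ∈ freqBall N, (⟪a k, ((-(4 * Real.pi ^ 2 : ℝ) : ℂ)) • symbT 𝔹 k (c k)⟫_ℂ).re|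
      ≤ ∑ k ∈ freqBall N, |(⟪a k, ((-(4 * Real.pi ^ 2 : ℝ) : ℂ)) • symbT 𝔹 k (c k)⟫_ℂ).re| := Finset.abs_sum_le_sum_abs _ _
    _ ≤ ∑ k ∈ freqBall N, (Real.sqrt (freqNormSq k) * ‖a k‖) * (4 * Real.pi ^ 2 * (hi + β / 2) * (Real.sqrt (freqNormSq k) * ‖c k‖)) :=
        Finset.sum_le_sum hterm
    _ ≤ Real.sqrt (∑ k ∈ freqBall N, (Real.sqrt (freqNormSq k) * ‖a k‖) ^ 2) *
          Real.sqrt (∑ k ∈ freqBall N, (4 * Real.pi ^ 2 * (hi + β / 2) * (Real.sqrt (freqNormSq k) * ‖c k‖)) ^ 2) :=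
        Real.sum_mul_le_sqrt_mul_sqrt _ _ _
    _ ≤ Real.sqrt ((N : ℝ) ^ 2 * ∫ x, ‖u x‖ ^ 2) * Real.sqrt ((4 * Real.pi ^ 2 * (hi + β / 2)) ^ 2 * (∑ k ∈ freqBall N, freqNormSq k * ‖mFourierCoeff (EuclideanSpace.complexify ∘ w) k‖ ^ 2)) := by
        rw [hsum_c]
        gcongr
    _ = 4 * Real.pi ^ 2 * (hi + β / 2) * N * Real.sqrt ((∑ k ∈ freqBall N, freqNormSq k * ‖mFourierCoeff (EuclideanSpace.complexify ∘ w) k‖ ^ 2)) * Real.sqrt (∫ x, ‖u x‖ ^ 2) := by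
        rw [Real.sqrt_mul (sq_nonneg _), Real.sqrt_mul (sq_nonneg _), Real.sqrt_sq (Nat.cast_nonneg N), Real.sqrt_sq hpos]
        ring

/-! ## §4 The generator pairing -/

/-- **THE GENERATOR APPLIED TO A BAND-LIMITED SOLENOIDAL TEST, PAIRED WITH A SOLENOIDAL `L²` SLICE**:
`|∫ ⟪u, (b·∇)P_N w + 𝓛_𝔹^* P_N w⟫| ≤ (6π·B + 4π²(hi + β/2)·N) · S_N(w) · ‖u‖₂`. [folklore] -/
theorem abs_integral_inner_generator_fourierTruncate_le {u b w : UnitAddTorus (Fin 3) → EuclideanSpace ℝ (Fin 3)} (hu : MemLp u 2 volume) (hudiv : Torus.IsWeaklyDivFree u)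
    (hb : AEStronglyMeasurable b volume) {B : ℝ} (hB0 : 0 ≤ B) (hB : ∀ x, ‖b x‖ ≤ B)
    (hw : MemLp w 2 volume) (hwdiv : Torus.IsWeaklyDivFree w)
    {𝔹 : Visc4 (Fin 3)} {lo hi β : ℝ} (h𝔹 : NearIso 𝔹 lo hi) (hlo : 0 ≤ lo) (hhi : 0 ≤ hi) (hodd : OddSmall 𝔹 β) (hβ : 0 ≤ β) (N : ℕ) :
    |∫ x, ⟪u x, Torus.convect b (fourierTruncate N w) x + viscAdj 𝔹 (fourierTruncate N w) x⟫_ℝ|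
      ≤ (6 * Real.pi * B + 4 * Real.pi ^ 2 * (hi + β / 2) * N) * Real.sqrt ((∑ k ∈ freqBall N, freqNormSq k * ‖mFourierCoeff (EuclideanSpace.complexify ∘ w) k‖ ^ 2)) * Real.sqrt (∫ x, ‖u x‖ ^ 2) := by
  have hG := isSmooth_fourierTruncate N w
  have hG1 : Torus.IsContDiff 1 (fourierTruncate N w) := hG.isContDiff (by simp)
  have hint : ∀ j, Integrable (fun x => b x j • u x) volume := fun j => (memLp_carrier_smul hu hb hB j).1.integrable one_le_two
  have hi₁ : Integrable (fun x => ⟪u x, Torus.convect b (fourierTruncate N w) x⟫_ℝ) volume := by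
    simp_rw [inner_convect_eq_sum_smul hG1]
    exact integrable_finsetSum _ fun j _ => integrable_inner_of_continuous (hint j) (hG.partialDeriv j).continuous
  have hi₂ : Integrable (fun x => ⟪u x, viscAdj 𝔹 (fourierTruncate N w) x⟫_ℝ) volume :=
    integrable_inner_of_continuous (hu.integrable one_le_two) (isSmooth_viscAdj 𝔹 hG).continuous
  simp_rw [inner_add_right]
  rw [integral_add hi₁ hi₂]
  have h1 := abs_integral_inner_convect_fourierTruncate_le w hu hb hB0 hB N
  have h2 := abs_integral_inner_viscAdj_fourierTruncate_le hu hudiv hw hwdiv h𝔹 hlo hhi hodd hβ N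
  calc |(∫ x, ⟪u x, Torus.convect b (fourierTruncate N w) x⟫_ℝ) + ∫ x, ⟪u x, viscAdj 𝔹 (fourierTruncate N w) x⟫_ℝ|
      ≤ |∫ x, ⟪u x, Torus.convect b (fourierTruncate N w) x⟫_ℝ| + |∫ x, ⟪u x, viscAdj 𝔹 (fourierTruncate N w) x⟫_ℝ| := abs_add_le _ _
    _ ≤ _ := by nlinarith [h1, h2, Real.sqrt_nonneg ((∑ k ∈ freqBall N, freqNormSq k * ‖mFourierCoeff (EuclideanSpace.complexify ∘ w) k‖ ^ 2)), Real.sqrt_nonneg (∫ x, ‖u x‖ ^ 2)]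

end Summit.AnomalousDissipation.AnomalousDissipation.Theorems.SolenoidalFractalHomogenisation.LagrangianStep.VmodFlat

end
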